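import Summits.HodgeConjecture.HodgeConjecture.Theorems.HeckePrymWeilWeilVariationalHodgeCurveDichotomy
import Summits.HodgeConjecture.HodgeConjecture.Theorems.AnchorTransportVariationalHodgeAnalyticInterior

/-!
# Route HeckePrymWeil — `WeilVariationalHodge` (stmt-HodgeConjecture-14497): the local form of the core

Skeleton v5 of line `Sketch` (lead c3) reduces the crux to the core `stub_anchorSpreadsUncountably`: along a
sectioned H-projective family of abelian `2M`-folds with `√-p` over a smooth irreducible affine CURVE `C`, one
algebraic fibre of a fibrewise-rational `(M,M)` global class `W` forces UNCOUNTABLY many algebraic fibres. Every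
deformation-theoretic engine in print (Bloch 1972 / Buchweitz–Flenner 2003 semiregularity, Pridham, Perry 2026;
Markman's secant sheaves) delivers algebraicity on a EUCLIDEAN NEIGHBOURHOOD of the anchor. This file records,
sorry-free, that such a local output is exactly enough, over a curve:

* `not_countable_algebraicityLocus_of_isOpen_curve` — a non-empty Euclidean-open set of algebraic fibres makes the
  algebraicity locus uncountable (non-empty opens of the real surface `C(ℂ)` are uncountable:
  `not_countable_of_isOpen_complexPoints`, stmt-1076 lead); no family hypothesis is needed;
* `mem_algebraicClasses_of_isOpen_curve` — hence, for a smooth projective family with quasi-projective total space,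
  algebraic on a non-empty Euclidean-open set of `C(ℂ)` ⇒ algebraic at EVERY complex point (the curve case of the
  tree's `map_fiberι_mem_algebraicClasses_of_isOpen`, here through the all-or-countable dichotomy
  `mem_algebraicClasses_of_not_countable_curve`, p141888);
* `anchorSpreadsUncountably_of_localTransport` — **LOCAL(p, M) ⇒ CORE(p, M)**: if along every family of the core
  an algebraic anchor propagates to SOME non-empty Euclidean-open set of `C(ℂ)`, the core stub holds. LOCAL is the
  typed target an engine for this crux must hit.
-/

noncomputable section

-- every declaration of this problem lives in `Summit.HodgeConjecture.HodgeConjecture.…` (summit = sub-problem)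
set_option linter.dupNamespace false

open CategoryTheory AlgebraicGeometry TopologicalSpace MonoidalCategory
open Literature.AlgebraicGeometry.Motives Literature.AlgebraicGeometry.HodgeTheory

namespace Summit.HodgeConjecture.HodgeConjecture.Theorems

/-- **A non-empty Euclidean-open set of algebraic fibres makes the algebraicity locus uncountable** (over a
smooth irreducible affine curve `C`; any `f : 𝒳 ⟶ C`, any class): the open set is uncountable
(`not_countable_of_isOpen_complexPoints`; `C` is smooth of relative dimension `1`,
`isIntegral_and_smoothOfRelativeDimension_one`) and lies in the locus. [cite: SerreGAGA1956, §2 n°5 Prop. 2 and n°6] -/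
theorem not_countable_algebraicityLocus_of_isOpen_curve {q : ℕ} {𝒳 C : SchemeOver ℂ} (f : 𝒳 ⟶ C)
    [IrreducibleSpace C.left] [AlgebraicGeometry.Smooth C.hom] (hdim : topologicalKrullDim C.left = 1)
    (A : complexBetti 𝒳 (2 * q)) {U : Set (ComplexPoints C)} (hU : IsOpen U) (hUne : U.Nonempty)
    (halg : ∀ t ∈ U, complexBetti.map (fiberι f t) (2 * q) A ∈ algebraicClasses (fiberOver f t) q) :
    ¬ Set.Countable {t : ComplexPoints C |
      complexBetti.map (fiberι f t) (2 * q) A ∈ algebraicClasses (fiberOver f t) q} := by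
  obtain ⟨_, hm⟩ := isIntegral_and_smoothOfRelativeDimension_one C hdim
  haveI := hm
  exact fun hc => not_countable_of_isOpen_complexPoints C (n := 1) le_rfl hU hUne (hc.mono fun t ht => halg t ht)

/-- **Algebraic on a non-empty Euclidean-open set of the curve ⇒ algebraic at every complex point**, for a
smooth projective family with quasi-projective total space over a smooth irreducible affine curve
(`not_countable_algebraicityLocus_of_isOpen_curve` + `mem_algebraicClasses_of_not_countable_curve`).
[cite: CharlesSchnell2014Notes, Prop. 11.3.11 (proof)] [cite: VoisinHodgeII2003, §7.3.2, proof of Thm. 7.19] -/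
theorem mem_algebraicClasses_of_isOpen_curve {n q : ℕ} {𝒳 C : SchemeOver ℂ} (f : 𝒳 ⟶ C)
    (hf : IsSmoothProjectiveFamily f n) (h𝒳 : IsQuasiProjectiveOver 𝒳) [IrreducibleSpace C.left]
    [IsAffine C.left] [AlgebraicGeometry.Smooth C.hom] (hdim : topologicalKrullDim C.left = 1)
    (A : complexBetti 𝒳 (2 * q)) {U : Set (ComplexPoints C)} (hU : IsOpen U) (hUne : U.Nonempty)
    (halg : ∀ t ∈ U, complexBetti.map (fiberι f t) (2 * q) A ∈ algebraicClasses (fiberOver f t) q)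
    (t : ComplexPoints C) :
    complexBetti.map (fiberι f t) (2 * q) A ∈ algebraicClasses (fiberOver f t) q :=
  mem_algebraicClasses_of_not_countable_curve f hf h𝒳 hdim A
    (not_countable_algebraicityLocus_of_isOpen_curve f hdim A hU hUne halg) t

/-- **LOCAL(p, M) ⇒ CORE(p, M).** If, along every sectioned smooth projective family of abelian `2M`-folds with
`√-p`-multiplication and quasi-projective total space over a smooth irreducible affine curve, an algebraic
anchor of a fibrewise-rational `(M,M)` global class propagates to SOME non-empty Euclidean-open subset of
`C(ℂ)` (the output of every semiregularity / secant-sheaf engine), then the core stub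
`stub_anchorSpreadsUncountably` of skeleton v5 holds (`not_countable_algebraicityLocus_of_isOpen_curve`).
[cite: SerreGAGA1956, §2 n°5 Prop. 2 and n°6] -/
theorem anchorSpreadsUncountably_of_localTransport (p M : ℕ)
    (hL : ∀ ⦃𝒳 C : SchemeOver ℂ⦄ (f : 𝒳 ⟶ C) (e : C ⟶ 𝒳), e ≫ f = 𝟙 C → IsSmoothProjectiveFamily f (2 * M) →
      IsQuasiProjectiveOver 𝒳 → IrreducibleSpace C.left → IsAffine C.left → AlgebraicGeometry.Smooth C.hom →
      topologicalKrullDim C.left = 1 → ∀ (W : complexBetti 𝒳 (2 * M)),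
      (∀ s : ComplexPoints C, IsRationalClass (complexBetti.map (fiberι f s) (2 * M) W) ∧
        IsOfHodgeType (2 * M) (fiberOver f s) (2 * M) M M (complexBetti.map (fiberι f s) (2 * M) W)) →
      (∀ s : ComplexPoints C, ∃ (A' : AbelianVariety ℂ) (φ' : A' ⟶ A'), A'.dim = (2 * M) ∧
        φ' ≫ φ' = -((p : ℤ) • 𝟙 A') ∧ Nonempty (A'.X ≅ fiberOver f s)) →
      (∃ s₀ : ComplexPoints C, complexBetti.map (fiberι f s₀) (2 * M) W ∈ algebraicClasses (fiberOver f s₀) M) →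
      ∃ U : Set (ComplexPoints C), IsOpen U ∧ U.Nonempty ∧
        ∀ t ∈ U, complexBetti.map (fiberι f t) (2 * M) W ∈ algebraicClasses (fiberOver f t) M) :
    ∀ ⦃𝒳 C : SchemeOver ℂ⦄ (f : 𝒳 ⟶ C) (e : C ⟶ 𝒳), e ≫ f = 𝟙 C → IsSmoothProjectiveFamily f (2 * M) →
      IsQuasiProjectiveOver 𝒳 → IrreducibleSpace C.left → IsAffine C.left → AlgebraicGeometry.Smooth C.hom →
      topologicalKrullDim C.left = 1 → ∀ (W : complexBetti 𝒳 (2 * M)),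
      (∀ s : ComplexPoints C, IsRationalClass (complexBetti.map (fiberι f s) (2 * M) W) ∧
        IsOfHodgeType (2 * M) (fiberOver f s) (2 * M) M M (complexBetti.map (fiberι f s) (2 * M) W)) →
      (∀ s : ComplexPoints C, ∃ (A' : AbelianVariety ℂ) (φ' : A' ⟶ A'), A'.dim = (2 * M) ∧
        φ' ≫ φ' = -((p : ℤ) • 𝟙 A') ∧ Nonempty (A'.X ≅ fiberOver f s)) →
      (∃ s₀ : ComplexPoints C, complexBetti.map (fiberι f s₀) (2 * M) W ∈ algebraicClasses (fiberOver f s₀) M) →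
      ¬ Set.Countable {t : ComplexPoints C |
          complexBetti.map (fiberι f t) (2 * M) W ∈ algebraicClasses (fiberOver f t) M} := by
  intro 𝒳 C f e he hf hqp hirr haff hsm hdim W hW hA hanch
  haveI := hirr
  haveI := hsm
  obtain ⟨U, hU, hUne, halg⟩ := hL f e he hf hqp hirr haff hsm hdim W hW hA hanch
  exact not_countable_algebraicityLocus_of_isOpen_curve f hdim W hU hUne halg

end Summit.HodgeConjecture.HodgeConjecture.Theorems

end
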